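import Summits.QuantumFields.BalabanUV.Beta.EriceRemainderEnclosureHistoryAutonomyComparisonGapPersistence

/-!
# EriceRemainderEnclosureHistoryAutonomyComparisonStepExact — (E117c) THE EXACT RENEWAL IDENTITY ALONG THE ORBIT: THE DAMPING IS THE PERTURBED FLOW'S PIN
# SENSITIVITY.  (E63a) `step_ge_renewal` makes the step quantities `X(p) = B′(S′p) − B(S p)` along the base orbit a SUPERSOLUTION of the undamped first-order
# system; here the identity is written WITHOUT loss.  For box solutions `h`, `h′` of `B`, `B′` from one pin (solution families `S`, `S′` with uniqueness; nothing
# else — no sign, no size): **`levelGap_eq_sum_step`** —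
#     `1∕h′_m² − 1∕h_m² = Σ_{l<m} (X(h_{l+1}) − PS′(l+1))`,   `PS′(l+1) = B′(S′(h_{l+1})) − B′(S′(h′_{l+1}))`
# (autonomy: the tails are family members; the increment of the level gap at the scale `l+1` is the step quantity at the BASE pin `h_{l+1}` minus the PIN SENSITIVITY of
# the perturbed effective β-function between the two pins `h′_{l+1} ≤ h_{l+1}`); **`pinSens_nonneg`** — `PS′ ≥ 0` for `B′` isotone (with modulus and floor, so that `S′`
# is monotone in the pin, (E48a) `le_of_pin_le`) when `h′ ≤ h`; and for an AFFINE memory `B = β₀ + Σ_{k<K} L_k·u_k`: **`step_eq_exact`** —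
#     `B′h′ − B h = (B′ − B)(h′) − Σ_{k<K} L_k·h_k³·s_k·Σ_{l<k} (X(h_{l+1}) − PS′(l+1))`,   `s_k = (h′_k∕h_k)²∕(1 + h′_k∕h_k) ∈ (0, ½]`
# ((E64a) `gap_eq_levelGap_mul`).  So along the orbit `X_n = e_n + P_n − R̃^{(n)}X(n)` EXACTLY: the reads carry the rates `L_kh_{n+k}³·s_k ≤ L_kh_{n+k}³∕2` and the
# DAMPING of `HOME/b2b-balaban-beta-d4-p2/g62/e71/README.md` is `P_n = Σ_k L_kh³s_k·Σ_l PS′ ≥ 0` — first order in the gaps, NOT a perturbation.  What the NONLINEAR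
# step of the comparison column ((E58a)) needs beyond the first-order END of (E116d)∕(E117b) is therefore ONE estimate: the differenced damping `P_n − P_{n+1}` against
# the row budget's margin (README `HOME/b2b-balaban-beta-d4-p2/g97/README.md` §4 (1)).

Cell `pub-balaban`, β-function sub-cell, BINDER row D4 «RemainderConst leaves for Bałaban's split» (`HOME/BINDER-OWNERS.md`; owner lineage `b2b-balaban-beta-an4`;
this file by co-owner #2 lineage `b2b-balaban-beta-d4-p2`, generation 97), β-FLOW TEAM duty (1), FREEZE (0) honoured (def-free; imports (E64a) `…ComparisonGapPersistence`;
uses its `gap_eq_levelGap_mul`, (E48a)'s `memFlow_tail` ∕ `le_of_pin_le`, node U2's `MemFlow` ∕ `SeqBox` ∕ `seqBox_shift` BY NAME; nothing restated).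

HONEST FRAMING (page 1, verbatim and binding).  *"Discharging BetaPertH makes Bałaban's UV stability UNCONDITIONAL — a real constructive-QFT result; it is
NOT the continuum limit and NOT the Clay problem."*  THIS FILE DISCHARGES NOTHING OF THE KIND.  Elementary real analysis about ABSTRACT functionals on a box
]0,γ]^ℕ with displayed floors, moduli, profiles and signs — hypotheses of a census, not facts; the form, signs, ages and moments of Bałaban's (1.22) limit
functional are NOT PRINTED ([I] p. 298; GAPS G-t4-U2-1∕-2) and NOT asserted.  Row D4 class UNCHANGED (critical-path width 0; instance 0∕1; D4 DISCHARGE NO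
DATE).  HONEST DEPENDENCY: continuum YM on T⁴ ⇐ BetaPertH ∧ nine spine estimates (0/9 proved); BetaPertH ⇐ (D1) ∧ (D4) ∧ CAP+tail; G-an2-4 gates asym, D1
and NE2/3/4.  NOT CLAIMED: the nonlinear step; any bound on `P_n − P_{n+1}`; anything printed — NOT B12 Thm 2, NOT BetaPertH, NOT continuum, NOT Clay.

WHAT IS PROVED ([folklore]; 0 `def`, 0 sorry).  **`levelGap_eq_sum_step`**, **`pinSens_nonneg`**, `shape_le_half`, **`step_eq_exact`**.
-/

noncomputable section
open Finset Set

namespace Summit.QuantumFields.BalabanUV.Beta.EriceRemainderEnclosureHistoryAutonomyComparisonStepExact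

open Literature.MathematicalPhysics.QuantumFieldTheory.Balaban1983to89
open Literature.MathematicalPhysics.QuantumFieldTheory.Balaban1983to89.T4BetaStationary
open Literature.MathematicalPhysics.QuantumFieldTheory.Balaban1983to89.T4BetaFlowWellPosed
open Summit.QuantumFields.BalabanUV.Beta.EriceRemainderEnclosureHistoryAutonomyOrder (memFlow_tail le_of_pin_le)
open Summit.QuantumFields.BalabanUV.Beta.EriceRemainderEnclosureHistoryAutonomyComparisonGapPersistence (gap_eq_levelGap_mul)

variable {B B' : (ℕ → ℝ) → ℝ} {γ y M' : ℝ} {L : ℕ → ℝ} {K : ℕ} {h h' : ℕ → ℝ} {S S' : ℝ → ℕ → ℝ}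

/-- **THE LEVEL GAP IS THE SUM OF THE STEP QUANTITIES AT THE BASE PINS MINUS THE PERTURBED PIN SENSITIVITIES — EXACTLY.**  Solution families `S`, `S′` of `B`,
`B′` on the box (unique), `h`, `h′` box solutions of `B`, `B′` from ONE pin `y`.  Then for every `m`:
`1∕h′_m² − 1∕h_m² = Σ_{l<m} ([B′(S′(h_{l+1})) − B(S(h_{l+1}))] − [B′(S′(h_{l+1})) − B′(S′(h′_{l+1}))])`.  No sign, size or order hypothesis. [folklore] -/
theorem levelGap_eq_sum_step
    (hS : ∀ p, 0 < p → p ≤ γ → SeqBox γ (S p) ∧ MemFlow B p (S p))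
    (huniq : ∀ p, 0 < p → p ≤ γ → ∀ u u' : ℕ → ℝ, SeqBox γ u → SeqBox γ u' → MemFlow B p u → MemFlow B p u' → u = u')
    (hS' : ∀ p, 0 < p → p ≤ γ → SeqBox γ (S' p) ∧ MemFlow B' p (S' p))
    (huniq' : ∀ p, 0 < p → p ≤ γ → ∀ u u' : ℕ → ℝ, SeqBox γ u → SeqBox γ u' → MemFlow B' p u → MemFlow B' p u' → u = u')
    (hh : SeqBox γ h) (hf : MemFlow B y h) (hh' : SeqBox γ h') (hf' : MemFlow B' y h') :
    ∀ m : ℕ, 1 / h' m ^ 2 - 1 / h m ^ 2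
      = ∑ l ∈ range m, ((B' (S' (h (l + 1))) - B (S (h (l + 1)))) - (B' (S' (h (l + 1))) - B' (S' (h' (l + 1))))) := by
  intro m
  induction m with
  | zero => rw [hf.1, hf'.1]; simp
  | succ m ih =>
    rw [hf.2 m, hf'.2 m, sum_range_succ]
    have hm := hh (m + 1)
    have hm' := hh' (m + 1)
    have et : (fun j => h (m + 1 + j)) = S (h (m + 1)) :=
      huniq _ hm.1 hm.2 _ _ (seqBox_shift hh (m + 1)) (hS _ hm.1 hm.2).1 (memFlow_tail hf (m + 1)) (hS _ hm.1 hm.2).2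
    have et' : (fun j => h' (m + 1 + j)) = S' (h' (m + 1)) :=
      huniq' _ hm'.1 hm'.2 _ _ (seqBox_shift hh' (m + 1)) (hS' _ hm'.1 hm'.2).1 (memFlow_tail hf' (m + 1)) (hS' _ hm'.1 hm'.2).2
    rw [et, et']
    linarith

/-- **THE PIN SENSITIVITY IS NON-NEGATIVE UNDER COMPARISON.**  `B′` isotone with a modulus `M′` and a floor `b′ > 0` (so that its solution family is monotone in the
pin, (E48a) `le_of_pin_le`); `h′ ≤ h` pointwise in the box.  Then `B′(S′(h′_n)) ≤ B′(S′(h_n))` for every `n`. [folklore] -/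
theorem pinSens_nonneg {b' : ℝ} (hmono' : ∀ u v : ℕ → ℝ, SeqBox γ u → SeqBox γ v → (∀ j, u j ≤ v j) → B' u ≤ B' v) (hb' : 0 < b')
    (hB' : ∀ u u' : ℕ → ℝ, SeqBox γ u → SeqBox γ u' → ∀ D : ℝ, (∀ j, |u j - u' j| ≤ D) → |B' u - B' u'| ≤ M' * D) (hM' : 0 ≤ M')
    (hlo' : ∀ u, SeqBox γ u → b' ≤ B' u)
    (hS' : ∀ p, 0 < p → p ≤ γ → SeqBox γ (S' p) ∧ MemFlow B' p (S' p))
    (huniq' : ∀ p, 0 < p → p ≤ γ → ∀ u u' : ℕ → ℝ, SeqBox γ u → SeqBox γ u' → MemFlow B' p u → MemFlow B' p u' → u = u')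
    (hh : SeqBox γ h) (hh' : SeqBox γ h') (hle : ∀ j, h' j ≤ h j) (n : ℕ) :
    0 ≤ B' (S' (h n)) - B' (S' (h' n)) := by
  have hn := hh n
  have hn' := hh' n
  have hpin : ∀ j, S' (h' n) j ≤ S' (h n) j := fun j =>
    le_of_pin_le hb' hB' hM' hlo' huniq' hn'.1 (hle n) hn.2 (hS' _ hn'.1 hn'.2).1 (hS' _ hn.1 hn.2).1
      (hS' _ hn'.1 hn'.2).2 (hS' _ hn.1 hn.2).2 j
  have := hmono' _ _ (hS' _ hn'.1 hn'.2).1 (hS' _ hn.1 hn.2).1 hpin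
  linarith

/-- The shape factor of the gap, `s = r²∕(1+r)` with `r = x′∕x ∈ (0,1]`, lies in `(0, ½]`. [folklore] -/
theorem shape_le_half {x x' : ℝ} (hx : 0 < x) (hx' : 0 < x') (hle : x' ≤ x) :
    0 < (x' / x) ^ 2 / (1 + x' / x) ∧ (x' / x) ^ 2 / (1 + x' / x) ≤ 1 / 2 := by
  have hr0 : 0 < x' / x := div_pos hx' hx
  have hr1 : x' / x ≤ 1 := (div_le_one hx).mpr hle
  refine ⟨by positivity, ?_⟩
  rw [div_le_iff₀ (by linarith)]
  nlinarith

/-- **THE EXACT RENEWAL IDENTITY AT A PIN (affine base memory).**  `B u = β₀ + Σ_{k<K} L_k·u_k`; `B′` arbitrary with a solution family; `h`, `h′` box solutions of `B`,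
`B′` from one pin.  Then, with `X(p) = B′(S′p) − B(S p)` and `PS′(l+1) = B′(S′(h_{l+1})) − B′(S′(h′_{l+1}))`:
`B′h′ − B h = (B′h′ − B h′) − Σ_{k<K} L_k·(h_k³·s_k)·Σ_{l<k} (X(h_{l+1}) − PS′(l+1))`, `s_k = (h′_k∕h_k)²∕(1 + h′_k∕h_k)` — the step quantity at the pin is the
excess minus the DAMPED reads (`h_k³s_k ≤ h_k³∕2`) of the deeper step quantities PLUS the reads of the perturbed pin sensitivities.  EXACT: no order, no size.
((E64a) `gap_eq_levelGap_mul` + `levelGap_eq_sum_step`.) [folklore] -/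
theorem step_eq_exact {β₀ : ℝ} (hBaff : ∀ u, B u = β₀ + ∑ k ∈ range K, L k * u k)
    (hS : ∀ p, 0 < p → p ≤ γ → SeqBox γ (S p) ∧ MemFlow B p (S p))
    (huniq : ∀ p, 0 < p → p ≤ γ → ∀ u u' : ℕ → ℝ, SeqBox γ u → SeqBox γ u' → MemFlow B p u → MemFlow B p u' → u = u')
    (hS' : ∀ p, 0 < p → p ≤ γ → SeqBox γ (S' p) ∧ MemFlow B' p (S' p))
    (huniq' : ∀ p, 0 < p → p ≤ γ → ∀ u u' : ℕ → ℝ, SeqBox γ u → SeqBox γ u' → MemFlow B' p u → MemFlow B' p u' → u = u')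
    (hh : SeqBox γ h) (hf : MemFlow B y h) (hh' : SeqBox γ h') (hf' : MemFlow B' y h') :
    B' h' - B h = (B' h' - B h')
      - ∑ k ∈ range K, L k * (h k ^ 3 * ((h' k / h k) ^ 2 / (1 + h' k / h k)))
          * ∑ l ∈ range k, ((B' (S' (h (l + 1))) - B (S (h (l + 1)))) - (B' (S' (h (l + 1))) - B' (S' (h' (l + 1))))) := by
  have hD := levelGap_eq_sum_step hS huniq hS' huniq' hh hf hh' hf'
  -- the affine drop, gap by gap
  have hdrop : B h - B h' = ∑ k ∈ range K, L k * (h k - h' k) := by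
    rw [hBaff h, hBaff h', add_sub_add_left_eq_sub, ← sum_sub_distrib]
    exact sum_congr rfl fun k _ => by ring
  have hgap : ∀ k, h k - h' k = (1 / h' k ^ 2 - 1 / h k ^ 2) * h k ^ 3 * ((h' k / h k) ^ 2 / (1 + h' k / h k)) := fun k =>
    gap_eq_levelGap_mul (hh k).1 (hh' k).1
  have hsum : ∑ k ∈ range K, L k * (h k - h' k)
      = ∑ k ∈ range K, L k * (h k ^ 3 * ((h' k / h k) ^ 2 / (1 + h' k / h k)))
          * ∑ l ∈ range k, ((B' (S' (h (l + 1))) - B (S (h (l + 1)))) - (B' (S' (h (l + 1))) - B' (S' (h' (l + 1))))) :=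
    sum_congr rfl fun k _ => by rw [hgap k, hD k]; ring
  linarith

end Summit.QuantumFields.BalabanUV.Beta.EriceRemainderEnclosureHistoryAutonomyComparisonStepExact

end
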